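import Mathlib
import HarnessLib

/-!
# Newton iteration for `y' = w y` (the exponential of a power series): precision doubling

Topic `Computability/AlgebraicComplexity`, namespace `Literature.Computability.AlgebraicComplexity`.
Everything PROVED; one definition (`integ`, the formal antiderivative with prescribed inverses of
`1, 2, 3, …`), no named facts.  Pure algebra — the companion circuit (two fast multiplications, one
Newton inversion and `O(M)` scalings per doubling, on `JointCircuits.lean` / `FFTCircuitCost.lean` /
`SeriesInverseCircuit.lean`) is left to the consumer.

The exponential `y = exp(∫ w)` of a power series is the solution of the first-order linear equation
`y' = w y`, `y(0) = 1`; Newton iteration for it (Brent 1976, §§5–6: elementary functions by Newton's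
method; Brent–Kung 1978; von zur Gathen–Gerhard §9.1) doubles the precision by
`y₁ = y₀ · (1 + ∫ (w − y₀' y₀^{-1}))`: if `y₀ ≡ y (mod X^M)` then `y₁ ≡ y (mod X^{2M})`.  This file
proves exactly that, over any commutative ring in which `1, 2, 3, …` have the inverses used by `∫`:

* `integ ninv e` (`= Σ_k ninv k · e_k X^{k+1}`), `derivativeFun_integ` (`(∫ e)' = e` when
  `(k+1) · ninv k = 1`);
* `coeff_eq_of_ode` : uniqueness — if `y' = w y`, `z' − w z ≡ 0 (mod X^K)` and `z(0) = y(0)` then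
  `z ≡ y (mod X^{K+1})`;
* `coeff_newton_expODE` : the doubling step above (with `q` the inverse of `y₀`), via the identity
  `z' − w z = (∫e) · (y₀' − w y₀)` for `z = y₀ (1 + ∫ e)`, `e = w − y₀' q = −(y₀' − w y₀) q`.

No `exp`, `log` or substitution of power series is used: a consumer realises a truncated product
`∏_l g_l(x_l s)` as THE solution of `y' = W y` with `W = Σ_l x_l (g_l'/g_l)(x_l s)`.

## References

* R. P. Brent, *Fast multiple-precision evaluation of elementary functions*, J. ACM 23 (1976),
  §§5–6 (Newton's method for `exp` / first-order equations). [Brent1976]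
* J. von zur Gathen, J. Gerhard, *Modern Computer Algebra*, CUP (3rd ed. 2013), §9.1 (Newton
  iteration). [GathenGerhard2013]
-/

noncomputable section

namespace Literature.Computability.AlgebraicComplexity

section ExpODE

variable {S : Type*} [CommRing S]

open _root_.Finset _root_.PowerSeries

/-- **Formal antiderivative** with prescribed inverses: `integ ninv e = Σ_k ninv k · e_k X^{k+1}`
(`ninv k` plays `1/(k+1)`). [cite: Brent1976, §5] -/
def integ (ninv : ℕ → S) (e : S⟦X⟧) : S⟦X⟧ :=
  PowerSeries.mk fun j => if j = 0 then 0 else ninv (j - 1) * coeff (j - 1) e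

/-- `[X^0] ∫ e = 0`. [cite: Brent1976, §5] -/
theorem coeff_zero_integ (ninv : ℕ → S) (e : S⟦X⟧) : coeff 0 (integ ninv e) = 0 := by
  simp [integ, PowerSeries.coeff_mk]

/-- `[X^{k+1}] ∫ e = ninv k · e_k`. [cite: Brent1976, §5] -/
theorem coeff_succ_integ (ninv : ℕ → S) (e : S⟦X⟧) (j : ℕ) :
    coeff (j + 1) (integ ninv e) = ninv j * coeff j e := by
  simp [integ, PowerSeries.coeff_mk]

/-- **`(∫ e)' = e`** when `(k + 1) · ninv k = 1` for all `k`. [cite: Brent1976, §5] -/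
theorem derivativeFun_integ {ninv : ℕ → S} (hninv : ∀ j : ℕ, ((j : S) + 1) * ninv j = 1)
    (e : S⟦X⟧) : derivativeFun (integ ninv e) = e := by
  ext j
  rw [coeff_derivativeFun, coeff_succ_integ, mul_comm, ← mul_assoc, hninv j, one_mul]

/-- `X^K ∣ φ ↔` the first `K` coefficients vanish (restated for convenience). [folklore] -/
private theorem coeff_eq_zero_of_X_pow_dvd {φ : S⟦X⟧} {K : ℕ} (h : (X : S⟦X⟧) ^ K ∣ φ) :
    ∀ j < K, coeff j φ = 0 :=
  PowerSeries.X_pow_dvd_iff.mp h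

/-- **Uniqueness for `y' = w y` modulo `X^{K+1}`**: if `y' = w y`, `z' − w z ≡ 0 (mod X^K)` and
`z(0) = y(0)`, then `z ≡ y (mod X^{K+1})` (coefficient recurrence `(k+1) y_{k+1} = Σ_{i+j=k} w_i y_j`,
division by `k + 1` through `ninv`). [cite: Brent1976, §5] -/
theorem coeff_eq_of_ode {ninv : ℕ → S} (hninv : ∀ j : ℕ, ((j : S) + 1) * ninv j = 1)
    (w y z : S⟦X⟧) (K : ℕ) (hy : derivativeFun y = w * y)
    (hz : ∀ j < K, coeff j (derivativeFun z - w * z) = 0) (h0 : coeff 0 z = coeff 0 y) :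
    ∀ j ≤ K, coeff j z = coeff j y := by
  intro j
  induction j using Nat.strong_induction_on with
  | _ j ih =>
    intro hj
    rcases j with _ | j
    · exact h0
    · have hjK : j < K := by omega
      -- `(j+1) z_{j+1} = [X^j](w z) = [X^j](w y) = (j+1) y_{j+1}`
      have h1 : coeff j (derivativeFun z) = coeff j (w * z) := by
        have := hz j hjK
        rwa [map_sub, sub_eq_zero] at this
      have h2 : coeff j (w * z) = coeff j (w * y) := by
        rw [PowerSeries.coeff_mul, PowerSeries.coeff_mul]
        refine sum_congr rfl fun ij hij => ?_
        rw [Finset.HasAntidiagonal.mem_antidiagonal] at hij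
        rw [ih ij.2 (by omega) (by omega)]
      have h3 : coeff (j + 1) z * (j + 1) = coeff (j + 1) y * (j + 1) := by
        rw [← coeff_derivativeFun, ← coeff_derivativeFun, h1, h2, hy]
      calc coeff (j + 1) z = coeff (j + 1) z * (((j : S) + 1) * ninv j) := by rw [hninv, mul_one]
        _ = coeff (j + 1) y * (((j : S) + 1) * ninv j) := by
            rw [← mul_assoc, ← mul_assoc, h3]
        _ = coeff (j + 1) y := by rw [hninv, mul_one]

/-- **The Newton step for `y' = w y` doubles the precision** (Brent 1976 §6 / Brent–Kung 1978;
GG §9.1): if `y' = w y`, `y₀ ≡ y (mod X^M)` (`M ≥ 1`) and `q y₀ = 1`, then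
`y₀ · (1 + ∫ (w − y₀' q)) ≡ y (mod X^{2M})`.  Proof: with `r = y₀' − w y₀ ≡ 0 (mod X^{M-1})` one has
`e := w − y₀' q = −r q`, so `E := ∫ e ≡ 0 (mod X^M)`, and `z := y₀ (1 + E)` satisfies
`z' − w z = E r ≡ 0 (mod X^{2M-1})`, `z(0) = y(0)`; conclude by `coeff_eq_of_ode`.
[cite: Brent1976, §6] -/
theorem coeff_newton_expODE {ninv : ℕ → S} (hninv : ∀ j : ℕ, ((j : S) + 1) * ninv j = 1)
    (w y y₀ q : S⟦X⟧) (M : ℕ) (hM : 1 ≤ M) (hy : derivativeFun y = w * y)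
    (hy₀ : ∀ j < M, coeff j y₀ = coeff j y) (hq : q * y₀ = 1) :
    ∀ j < 2 * M, coeff j (y₀ * (1 + integ ninv (w - derivativeFun y₀ * q))) = coeff j y := by
  set r : S⟦X⟧ := derivativeFun y₀ - w * y₀ with hr
  set e : S⟦X⟧ := w - derivativeFun y₀ * q with he
  set E : S⟦X⟧ := integ ninv e with hE
  -- (a) `e = −r q`
  have hea : e = -(r * q) := by
    rw [he, hr]
    linear_combination (-w) * hq
  -- (b) `X^{M-1} ∣ r`
  have hrb : (X : S⟦X⟧) ^ (M - 1) ∣ r := by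
    rw [PowerSeries.X_pow_dvd_iff]
    intro j hj
    rw [hr, map_sub, sub_eq_zero, coeff_derivativeFun, hy₀ (j + 1) (by omega),
      ← coeff_derivativeFun, hy, PowerSeries.coeff_mul, PowerSeries.coeff_mul]
    refine sum_congr rfl fun ij hij => ?_
    rw [Finset.HasAntidiagonal.mem_antidiagonal] at hij
    rw [hy₀ ij.2 (by omega)]
  obtain ⟨R', hR'⟩ := hrb
  -- (d) `X^M ∣ E`
  have hEd : (X : S⟦X⟧) ^ M ∣ E := by
    rw [PowerSeries.X_pow_dvd_iff]
    intro j hj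
    rcases j with _ | j
    · exact coeff_zero_integ ninv e
    · rw [hE, coeff_succ_integ, hea, map_neg, hR', mul_assoc, PowerSeries.coeff_X_pow_mul',
        if_neg (by omega), neg_zero, mul_zero]
  obtain ⟨E', hE'⟩ := hEd
  -- (e) `z' − w z = E r`
  have hdz : derivativeFun (y₀ * (1 + E)) - w * (y₀ * (1 + E)) = E * r := by
    rw [derivativeFun_mul, derivativeFun_add, derivativeFun_one, zero_add, hE,
      derivativeFun_integ hninv, ← hE, smul_eq_mul, smul_eq_mul, hea, hr]
    linear_combination (-(derivativeFun y₀ - w * y₀)) * hq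
  -- (f) `X^{2M-1} ∣ E r`, so the residual vanishes below `2M - 1`
  have hres : ∀ j < 2 * M - 1, coeff j (derivativeFun (y₀ * (1 + E)) - w * (y₀ * (1 + E))) = 0 := by
    refine coeff_eq_zero_of_X_pow_dvd ?_
    rw [hdz, hE', hR', show X ^ M * E' * (X ^ (M - 1) * R') =
      (X : S⟦X⟧) ^ (2 * M - 1) * (E' * R') by
        rw [show 2 * M - 1 = M + (M - 1) by omega, pow_add]; ring]
    exact dvd_mul_right _ _
  -- (g) constant terms
  have h0 : coeff 0 (y₀ * (1 + E)) = coeff 0 y := by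
    rw [PowerSeries.coeff_mul, Finset.Nat.antidiagonal_zero, sum_singleton, map_add,
      PowerSeries.coeff_one, if_pos rfl, hE, coeff_zero_integ, add_zero, mul_one]
    exact hy₀ 0 (by omega)
  -- (h) uniqueness
  intro j hj
  exact coeff_eq_of_ode hninv w y _ (2 * M - 1) hy hres h0 j (by omega)

end ExpODE

end Literature.Computability.AlgebraicComplexity

end
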